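import Literature.AlgebraicGeometry.Frobenioids.EquivalenceFrobeniusQuasiIsotropic
import Literature.AlgebraicGeometry.Frobenioids.BaseCategoryTheoreticity
import HarnessLib

/-!
# Frobenioids I, Theorem 3.4 (iv), first clause under the hypotheses (a), (b), (c) AS STATED:
# the case split «non-group-like objects exist / group-like type» (closer logic, proof-only)

Mochizuki, *The geometry of Frobenioids I: the general theory*, Kyushu J. Math. **62** (2008)
293–400, Thm. 3.4 (iv) p. 62 l. 36 – p. 63 l. 4 [cite: MochizukiFrdI2008, Thm. 3.4 (iv) p.63]:

> "(iv) Suppose that: (a) `C_1`, `C_2` are of standard type; (b) if `C_1`, `C_2` are of group-like type,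
> then both `Ψ` and some quasi-inverse to `Ψ` preserve base-isomorphisms; (c) `D_1`, `D_2` are
> Frobenius-slim. Then `Ψ` preserves the submonoids "`O^▷(−)`", "`O^×(−)`" …"

PROOF-ONLY file (abc-iut cell, sub-node `FrdI:Thm3.4(iv)/L08 UnitsDivisorsPreserved` of
plan/L1/SUBDAG-FrdI-Thm34.md, seat abc-iut-w4-d093): the LOGIC that turns the core transport theorem of
Thm. 3.4 (iv) — "`Ψ` preserves `O^▷(−)` as soon as `Ψ` preserves base-isomorphisms and linear morphisms and
`Ψ⁻¹` preserves pull-back morphisms, `C₁` being of Frobenius-normalized type and `D₂` Frobenius-slim" (the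
printed route p. 66 via Prop. 3.3 (i); in the tree as `EquivalenceUnitsFrobeniusSlim.lean`, entered here BY
NAME as the hypothesis `core` so that this file does not depend on which of the concurrently filed versions
lands) — into the first two conjuncts of the typed `PreFrobenioidData.Thm34iv` shape under (a), (b), (c) over
FSM-type bases (the cell's repaired base hypothesis). The case split of the print ("if `C_1`, `C_2` are of
group-like type …"): if `C₁` admits a non-group-like object then so does `C₂` (`exists_not_isGroupLikeObj_map`,
by abc-iut-L1-t13's `FrdI.thm34ii_of_isOfFSMType` for `Ψ⁻¹`) and Thm. 3.4 (iii) over FSM-type bases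
(`FrdI.thm34iii_morphisms_of_isOfFSMType`, for `Ψ` and `Ψ⁻¹`) supplies the three inputs; otherwise both sides
are of group-like type (`isOfGroupLikeType_map`), (b) supplies the base-isomorphisms, and the Thm. 3.4 (iii)
morphism list in group-like type (sub-node `(iii)/L01g`, seat abc-iut-w4-d088) supplies "linear" and
"pull-back" — entered BY NAME as `hGlin`, `hGpb`. The `O^×(−)` clause is the `O^▷(−)` clause at automorphisms.
Nothing of [FrdI] is restated as a named fact; no statement of the paper is strengthened.
-/

namespace Literature.AlgebraicGeometry.Frobenioids

open CategoryTheory Opposite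

namespace FrdI

universe w v v' u u'

variable {D₁ : Type u} [Category.{v} D₁] {Φ₁ : D₁ᵒᵖ ⥤ CommMonCat.{w}} {C₁ : Type u'} [Category.{v'} C₁]
  {D₂ : Type u} [Category.{v} D₂] {Φ₂ : D₂ᵒᵖ ⥤ CommMonCat.{w}} {C₂ : Type u'} [Category.{v'} C₂]
  {F₁ : C₁ ⥤ ElemFrobenioid Φ₁} {F₂ : C₂ ⥤ ElemFrobenioid Φ₂}

/-- Over FSM-type bases (quasi-isotropic type), if `C₁` admits a non-group-like object then so does `C₂`:
`Ψ⁻¹` preserves group-like objects (Thm. 3.4 (ii), `FrdI.thm34ii_of_isOfFSMType`) and group-likeness is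
invariant under the unit isomorphism `A ≅ Ψ⁻¹Ψ A`. [cite: MochizukiFrdI2008, Thm. 3.4 (ii) p.62] -/
theorem exists_not_isGroupLikeObj_map (hF₁ : PreFrobenioid.IsFrobenioid F₁)
    (hF₂ : PreFrobenioid.IsFrobenioid F₂) (hq₁ : (PreFrobenioidData.ofFunctor Φ₁ F₁).IsOfQuasiIsotropicType)
    (hq₂ : (PreFrobenioidData.ofFunctor Φ₂ F₂).IsOfQuasiIsotropicType) (hD₁ : IsOfFSMType D₁)
    (hD₂ : IsOfFSMType D₂) (Ψ : C₁ ≌ C₂)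
    (hN₁ : ∃ A : C₁, ¬ (PreFrobenioidData.ofFunctor Φ₁ F₁).IsGroupLikeObj A) :
    ∃ A : C₂, ¬ (PreFrobenioidData.ofFunctor Φ₂ F₂).IsGroupLikeObj A := by
  obtain ⟨A, hA⟩ := hN₁
  refine ⟨Ψ.functor.obj A, fun hB => hA ?_⟩
  have h := (thm34ii_of_isOfFSMType hF₂ hF₁ hq₂ hq₁ hD₂ hD₁ Ψ.symm).2.2 hB
  rw [PreFrobenioidData.ofFunctor_isGroupLikeObj] at h ⊢
  exact PreFrobenioid.IsGroupLikeObj.of_iso F₁ (Ψ.unitIso.app A).symm h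

/-- Over FSM-type bases (quasi-isotropic type), if `C₁` is of group-like type then so is `C₂`: `Ψ` preserves
group-like objects (Thm. 3.4 (ii)) and every `B` is isomorphic to `Ψ Ψ⁻¹ B`.
[cite: MochizukiFrdI2008, Thm. 3.4 (ii) p.62] -/
theorem isOfGroupLikeType_map (hF₁ : PreFrobenioid.IsFrobenioid F₁)
    (hF₂ : PreFrobenioid.IsFrobenioid F₂) (hq₁ : (PreFrobenioidData.ofFunctor Φ₁ F₁).IsOfQuasiIsotropicType)
    (hq₂ : (PreFrobenioidData.ofFunctor Φ₂ F₂).IsOfQuasiIsotropicType) (hD₁ : IsOfFSMType D₁)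
    (hD₂ : IsOfFSMType D₂) (Ψ : C₁ ≌ C₂) (hG₁ : (PreFrobenioidData.ofFunctor Φ₁ F₁).IsOfGroupLikeType) :
    (PreFrobenioidData.ofFunctor Φ₂ F₂).IsOfGroupLikeType := by
  refine ⟨fun B => ?_⟩
  have h := (thm34ii_of_isOfFSMType hF₁ hF₂ hq₁ hq₂ hD₁ hD₂ Ψ).2.2 (hG₁.obj (Ψ.inverse.obj B))
  rw [PreFrobenioidData.ofFunctor_isGroupLikeObj] at h ⊢
  exact PreFrobenioid.IsGroupLikeObj.of_iso F₂ (Ψ.counitIso.app B) h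

/-- `O^×(A)` is `O^▷(A)` at automorphisms: a functor mapping `O^▷(A)` into `O^▷(Ψ A)` maps `O^×(A)` into
`O^×(Ψ A)`. [cite: MochizukiFrdI2008, Def. 1.2 (ii) p.22] -/
theorem mapIso_mem_unitsSubgroup_of_map_mem_endSubmonoid (Ψ : C₁ ⥤ C₂) {A : C₁}
    (h : ∀ f : End A, f ∈ (PreFrobenioidData.ofFunctor Φ₁ F₁).endSubmonoid A →
      Ψ.map f ∈ (PreFrobenioidData.ofFunctor Φ₂ F₂).endSubmonoid (Ψ.obj A))
    (u : Aut A) (hu : u ∈ (PreFrobenioidData.ofFunctor Φ₁ F₁).unitsSubgroup A) :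
    Ψ.mapIso u ∈ (PreFrobenioidData.ofFunctor Φ₂ F₂).unitsSubgroup (Ψ.obj A) :=
  h (show End A from u.hom) hu

/-- **[FrdI] Thm. 3.4 (iv), first clause, from the core transport theorem by the printed case split.**
Hypotheses: (a) `C₁`, `C₂` Frobenioids of standard type over FSM-type bases; (b) `HypB`; (c) `D₂`
Frobenius-slim (only the codomain side is used); the core transport theorem `core` (Prop. 3.3 (i) route:
base-isomorphisms and linear morphisms preserved by `Ψ`, pull-backs by `Ψ⁻¹`, `C₁` Frobenius-normalized, `D₂`
Frobenius-slim ⇒ `Ψ` preserves `O^▷(−)`); and, for the group-like-type case only, the Thm. 3.4 (iii) clauses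
"`Ψ` preserves linear morphisms" (`hGlin`) and "`Ψ⁻¹` preserves pull-back morphisms" (`hGpb`) under (b)
(sub-node `(iii)/L01g`). Conclusion: the first two conjuncts of the typed `PreFrobenioidData.Thm34iv` at
`ofFunctor`. [cite: MochizukiFrdI2008, Thm. 3.4 (iv) p.63] -/
theorem thm34iv_units_of_core (hF₁ : PreFrobenioid.IsFrobenioid F₁) (hF₂ : PreFrobenioid.IsFrobenioid F₂)
    (hs₁ : (PreFrobenioidData.ofFunctor Φ₁ F₁).IsOfStandardType)
    (hs₂ : (PreFrobenioidData.ofFunctor Φ₂ F₂).IsOfStandardType) (hD₁ : IsOfFSMType D₁) (hD₂ : IsOfFSMType D₂)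
    (Ψ : C₁ ≌ C₂)
    (hB : PreFrobenioidData.HypB (PreFrobenioidData.ofFunctor Φ₁ F₁) (PreFrobenioidData.ofFunctor Φ₂ F₂) Ψ)
    (hslim₂ : IsFrobeniusSlim D₂)
    (core : PreFrobenioidData.PreservesMor Ψ.functor (PreFrobenioidData.ofFunctor Φ₁ F₁).IsBaseIso
        (PreFrobenioidData.ofFunctor Φ₂ F₂).IsBaseIso →
      PreFrobenioidData.PreservesMor Ψ.inverse (PreFrobenioidData.ofFunctor Φ₂ F₂).IsPullbackMorphism
        (PreFrobenioidData.ofFunctor Φ₁ F₁).IsPullbackMorphism →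
      PreFrobenioidData.PreservesMor Ψ.functor (PreFrobenioidData.ofFunctor Φ₁ F₁).IsLinear
        (PreFrobenioidData.ofFunctor Φ₂ F₂).IsLinear →
      (PreFrobenioidData.ofFunctor Φ₁ F₁).IsOfFrobeniusNormalizedType → IsFrobeniusSlim D₂ →
        ∀ (A : C₁) (f : End A), f ∈ (PreFrobenioidData.ofFunctor Φ₁ F₁).endSubmonoid A →
          Ψ.functor.map f ∈ (PreFrobenioidData.ofFunctor Φ₂ F₂).endSubmonoid (Ψ.functor.obj A))
    (hGlin : (PreFrobenioidData.ofFunctor Φ₁ F₁).IsOfGroupLikeType →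
      (PreFrobenioidData.ofFunctor Φ₂ F₂).IsOfGroupLikeType →
        PreFrobenioidData.PreservesMor Ψ.functor (PreFrobenioidData.ofFunctor Φ₁ F₁).IsLinear
          (PreFrobenioidData.ofFunctor Φ₂ F₂).IsLinear)
    (hGpb : (PreFrobenioidData.ofFunctor Φ₁ F₁).IsOfGroupLikeType →
      (PreFrobenioidData.ofFunctor Φ₂ F₂).IsOfGroupLikeType →
        PreFrobenioidData.PreservesMor Ψ.inverse (PreFrobenioidData.ofFunctor Φ₂ F₂).IsPullbackMorphism
          (PreFrobenioidData.ofFunctor Φ₁ F₁).IsPullbackMorphism) :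
    (∀ (A : C₁) (α : End A), α ∈ (PreFrobenioidData.ofFunctor Φ₁ F₁).endSubmonoid A →
        Ψ.functor.map α ∈ (PreFrobenioidData.ofFunctor Φ₂ F₂).endSubmonoid (Ψ.functor.obj A)) ∧
      ∀ (A : C₁) (α : Aut A), α ∈ (PreFrobenioidData.ofFunctor Φ₁ F₁).unitsSubgroup A →
        Ψ.functor.mapIso α ∈ (PreFrobenioidData.ofFunctor Φ₂ F₂).unitsSubgroup (Ψ.functor.obj A) := by
  -- the three inputs of `core`, by the case split of the print
  have hinputs : PreFrobenioidData.PreservesMor Ψ.functor (PreFrobenioidData.ofFunctor Φ₁ F₁).IsBaseIso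
        (PreFrobenioidData.ofFunctor Φ₂ F₂).IsBaseIso ∧
      PreFrobenioidData.PreservesMor Ψ.inverse (PreFrobenioidData.ofFunctor Φ₂ F₂).IsPullbackMorphism
        (PreFrobenioidData.ofFunctor Φ₁ F₁).IsPullbackMorphism ∧
      PreFrobenioidData.PreservesMor Ψ.functor (PreFrobenioidData.ofFunctor Φ₁ F₁).IsLinear
        (PreFrobenioidData.ofFunctor Φ₂ F₂).IsLinear := by
    by_cases hN₁ : ∃ A : C₁, ¬ (PreFrobenioidData.ofFunctor Φ₁ F₁).IsGroupLikeObj A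
    · -- non-group-like objects on both sides: Thm. 3.4 (iii) over FSM-type bases for `Ψ` and `Ψ⁻¹`
      have hN₂ := exists_not_isGroupLikeObj_map hF₁ hF₂ hs₁.quasiIsotropic hs₂.quasiIsotropic hD₁ hD₂ Ψ hN₁
      have h := (thm34iii_morphisms_of_isOfFSMType hF₁ hF₂ hs₁.quasiIsotropic hs₂.quasiIsotropic hD₁ hD₂
        hs₁.nonDilating hs₂.nonDilating Ψ hN₁ hN₂).1
      have h' := (thm34iii_morphisms_of_isOfFSMType hF₂ hF₁ hs₂.quasiIsotropic hs₁.quasiIsotropic hD₂ hD₁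
        hs₂.nonDilating hs₁.nonDilating Ψ.symm hN₂ hN₁).1
      exact ⟨h.2.2.1, h'.2.2.2.2.1, h.2.1⟩
    · -- group-like type on both sides: (b) and the group-like Thm. 3.4 (iii) clauses
      push Not at hN₁
      have hG₁ : (PreFrobenioidData.ofFunctor Φ₁ F₁).IsOfGroupLikeType := ⟨hN₁⟩
      have hG₂ := isOfGroupLikeType_map hF₁ hF₂ hs₁.quasiIsotropic hs₂.quasiIsotropic hD₁ hD₂ Ψ hG₁
      exact ⟨(hB hG₁ hG₂).1, hGpb hG₁ hG₂, hGlin hG₁ hG₂⟩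
  obtain ⟨hbi, hpb', hlin⟩ := hinputs
  have hend := core hbi hpb' hlin hs₁.frobeniusNormalized hslim₂
  exact ⟨hend, fun A α hα => mapIso_mem_unitsSubgroup_of_map_mem_endSubmonoid Ψ.functor (hend A) α hα⟩

end FrdI

end Literature.AlgebraicGeometry.Frobenioids
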